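import Summits.NavierStokesRegularity.NavierStokesRegularity.Theses.CorkscrewDynamo
import Literature.Analysis.FluidPDE.VorticityCalculus

/-!
# `WindDynamoExists` — reductions (route CorkscrewDynamo, item stmt-NavierStokesRegularity-11287)

Structural lemmas serving the support item `WindDynamoExists` (the kinematic seed of the
corkscrew-dynamo bootstrap: a smooth divergence-free Type-I template wind `B` carrying a smooth
divergence-free eternal solution `Ω` of the wind-induction equation
`∂ₛΩ = curl((B + ½y) × Ω) + ΔΩ` in the growth class `(1+|y|)²|Ω(s,y)| ≤ K e^{μs}`, `μ ≥ 0`,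
with `Ω(0,·) ≢ 0`):

* `windDynamoExists_of_kinematicCorkscrewMode` — the planner's remark "implied by #4": a
  rotating-wave Floquet mode on which the rotation `R_θ` acts nontrivially is in particular a
  nonzero eternal solution in the class (if `Ω 0 = 0` then `R_θ (Ω 0 (R_{-θ} y)) = 0 = Ω 0 y`).
* `windDynamoExists_of_steadyProfile` — SEPARABLE REDUCTION (landing pad for constructors): a smooth
  divergence-free profile `F ≢ 0` with `(1+|y|)²|F| ≤ K` solving the steady eigen-equation
  `μ F = curl((B + ½y) × F) + ΔF` pointwise, `μ ≥ 0`, gives the witness `Ω(s,y) = e^{μs} F(y)`;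
  this removes the time variable (`IsSmoothSpaceTimeOn`, `timeDerivWithin`) from the item.
* `windDynamoExists_of_eigenpair` — COMPLEX-EIGENPAIR REDUCTION: a real pair `(F₁, F₂)` with
  `L F₁ = μF₁ − νF₂`, `L F₂ = νF₁ + μF₂` (`L F = curl((B+½y)×F) + ΔF`, `μ ≥ 0`) gives the rotating /
  oscillating witness `Ω(s) = Re(e^{(μ+iν)s}(F₁ + iF₂))`; this is the shape in which a certified
  (Galerkin + enclosure) eigenvalue computation would deliver the item.
-/

noncomputable section

open Set Function
open scoped ContDiff Laplacian InnerProductSpace RealInnerProductSpace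

set_option linter.dupNamespace false

namespace Summit.NavierStokesRegularity.NavierStokesRegularity.Theorems

open Summit.NavierStokesRegularity.NavierStokesRegularity.Theses.CorkscrewDynamo
open Literature.Analysis.FluidPDE

/-- `KinematicCorkscrewMode → WindDynamoExists` (the route's "bare seed, implied by #4"): forget the
axisymmetry of the template, the Floquet covariance and the period; the rotating-wave mode is
nonzero at `s = 0` because `R_θ` does not fix `Ω(0,·)` (a linear isometry fixes the zero field). -/
theorem windDynamoExists_of_kinematicCorkscrewMode (h : KinematicCorkscrewMode) :
    WindDynamoExists := by
  obtain ⟨C, B, Rot, -, hB, hBdiv, -, hBdec, Ω, L, θ, μ, K, -, hμ, hΩ, hΩdiv, hPDE, -, hgrowth,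
    y, hy⟩ := h
  refine ⟨C, B, hB, hBdiv, hBdec, Ω, μ, K, hμ, hΩ, hΩdiv, hPDE, hgrowth, ?_⟩
  intro h0
  apply hy
  rw [h0]
  simp

/-- Scalars pull out of the second slot of the cross product (bilinearity of Mathlib's
`crossProduct`, through the bundled `crossCLM` of `VectorCalculus`). -/
theorem windCross_smul_right (v w : EuclideanSpace ℝ (Fin 3)) (c : ℝ) :
    cross v (c • w) = c • cross v w := by
  rw [← crossCLM_apply, ← crossCLM_apply, map_smul]

/-- The field `z ↦ W z × F z` is differentiable where `W`, `F` are (product rule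
`hasFDerivAt_cross`). -/
theorem differentiableAt_windCross {W F : EuclideanSpace ℝ (Fin 3) → EuclideanSpace ℝ (Fin 3)}
    {y : EuclideanSpace ℝ (Fin 3)} (hW : DifferentiableAt ℝ W y) (hF : DifferentiableAt ℝ F y) :
    DifferentiableAt ℝ (fun z => cross (W z) (F z)) y :=
  (hasFDerivAt_cross hW.hasFDerivAt hF.hasFDerivAt).differentiableAt

/-- SEPARABLE REDUCTION of `WindDynamoExists`: a smooth, divergence-free, nonzero profile `F` in the
class `(1+|y|)²|F(y)| ≤ K` solving the steady wind-induction eigen-equation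
`μ F = curl((B + ½y) × F) + ΔF` with `μ ≥ 0`, for a smooth divergence-free template `B` inside the
Type-I envelope `(1+|y|)|B| + (1+|y|)²‖∇B‖ ≤ C`, yields the eternal solution `Ω(s,y) = e^{μs} F(y)`
(time derivative `μ e^{μs} F`, right-hand side `e^{μs}(curl((B+½y)×F) + ΔF)` by linearity,
growth `(1+|y|)²|Ω| ≤ K e^{μs}`, `Ω 0 = F ≠ 0`). -/
theorem windDynamoExists_of_steadyProfile (C μ K : ℝ)
    (B F : EuclideanSpace ℝ (Fin 3) → EuclideanSpace ℝ (Fin 3))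
    (hB : ContDiff ℝ (⊤ : ℕ∞) B) (hBdiv : VectorCalculus.IsDivFree B)
    (hBdec : ∀ y, (1 + ‖y‖) * ‖B y‖ + (1 + ‖y‖) ^ 2 * ‖fderiv ℝ B y‖ ≤ C)
    (hF : ContDiff ℝ (⊤ : ℕ∞) F) (hFdiv : VectorCalculus.IsDivFree F) (hμ : 0 ≤ μ)
    (hPDE : ∀ y, μ • F y = curl (fun z => cross (B z + (1 / 2 : ℝ) • z) (F z)) y + Δ F y)
    (hdec : ∀ y, (1 + ‖y‖) ^ 2 * ‖F y‖ ≤ K) (hF0 : F ≠ 0) :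
    WindDynamoExists := by
  set Ω : ℝ → EuclideanSpace ℝ (Fin 3) → EuclideanSpace ℝ (Fin 3) :=
    fun s y => Real.exp (μ * s) • F y with hΩdef
  have hFD : Differentiable ℝ F := hF.differentiable (by simp)
  have hBD : Differentiable ℝ B := hB.differentiable (by simp)
  have hWd : ∀ y,
      DifferentiableAt ℝ (fun z : EuclideanSpace ℝ (Fin 3) => B z + (1 / 2 : ℝ) • z) y :=
    fun y => by fun_prop
  refine ⟨C, B, hB, hBdiv, hBdec, Ω, μ, K, hμ, ?_, ?_, ?_, ?_, ?_⟩
  · -- joint smoothness of `(s, y) ↦ e^{μ s} • F y`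
    have h1 : ContDiff ℝ ∞ (fun p : ℝ × EuclideanSpace ℝ (Fin 3) => Real.exp (μ * p.1)) :=
      Real.contDiff_exp.comp (contDiff_const.mul contDiff_fst)
    have h2 : ContDiff ℝ ∞ (fun p : ℝ × EuclideanSpace ℝ (Fin 3) => F p.2) :=
      hF.comp contDiff_snd
    have h3 : ContDiff ℝ ∞ (uncurry Ω) := by
      have : uncurry Ω =
          fun p : ℝ × EuclideanSpace ℝ (Fin 3) => Real.exp (μ * p.1) • F p.2 := by
        funext p; rfl
      rw [this]; exact h1.smul h2
    exact h3.contDiffOn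
  · -- divergence-free slices
    intro s x
    have hf : fderiv ℝ (Ω s) x = Real.exp (μ * s) • fderiv ℝ F x := by
      show fderiv ℝ (fun y => Real.exp (μ * s) • F y) x = _
      exact fderiv_fun_const_smul (hFD x) _
    have := hFdiv x
    simp only [VectorCalculus.divergence] at this ⊢
    rw [hf, ContinuousLinearMap.toLinearMap_smul, map_smul, this, smul_zero]
  · -- the equation
    intro s y
    have ht : timeDerivWithin Set.univ Ω s y = (Real.exp (μ * s) * μ) • F y := by
      rw [timeDerivWithin_apply, derivWithin_univ]
      have h1 : HasDerivAt (fun x : ℝ => μ * x) (μ * 1) s := (hasDerivAt_id' s).const_mul μ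
      have h2 : HasDerivAt (fun x : ℝ => Real.exp (μ * x)) (Real.exp (μ * s) * (μ * 1)) s :=
        (Real.hasDerivAt_exp (μ * s)).comp s h1
      have h3 := h2.smul_const (F y)
      simpa [hΩdef] using h3.deriv
    have hcross : (fun z => cross (B z + (1 / 2 : ℝ) • z) (Ω s z)) =
        fun z => Real.exp (μ * s) • cross (B z + (1 / 2 : ℝ) • z) (F z) := by
      funext z
      exact windCross_smul_right _ _ _
    have hcurl : curl (fun z => cross (B z + (1 / 2 : ℝ) • z) (Ω s z)) y =
        Real.exp (μ * s) • curl (fun z => cross (B z + (1 / 2 : ℝ) • z) (F z)) y := by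
      rw [hcross]
      exact curl_const_smul (differentiableAt_windCross (hWd y) (hFD y)) _
    have hlap : Δ (Ω s) y = Real.exp (μ * s) • Δ F y := by
      have : Ω s = Real.exp (μ * s) • F := by funext z; rfl
      rw [this]
      exact InnerProductSpace.laplacian_smul _ (hF.contDiffAt.of_le (by norm_cast))
    rw [ht, hcurl, hlap, ← smul_add, ← hPDE y, smul_smul]
  · -- growth class
    intro s y
    have hexp : 0 < Real.exp (μ * s) := Real.exp_pos _
    have : ‖Ω s y‖ = Real.exp (μ * s) * ‖F y‖ := by
      show ‖Real.exp (μ * s) • F y‖ = _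
      rw [norm_smul, Real.norm_of_nonneg hexp.le]
    rw [this]
    calc (1 + ‖y‖) ^ 2 * (Real.exp (μ * s) * ‖F y‖)
        = ((1 + ‖y‖) ^ 2 * ‖F y‖) * Real.exp (μ * s) := by ring
      _ ≤ K * Real.exp (μ * s) := mul_le_mul_of_nonneg_right (hdec y) hexp.le
  · -- nontriviality at `s = 0`
    have : Ω 0 = F := by
      funext y
      simp [hΩdef]
    rw [this]
    exact hF0

/-- The second slot of the cross product is additive (through the bundled `crossCLM`). -/
theorem windCross_sub_right (v w₁ w₂ : EuclideanSpace ℝ (Fin 3)) :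
    cross v (w₁ - w₂) = cross v w₁ - cross v w₂ := by
  rw [← crossCLM_apply, ← crossCLM_apply, ← crossCLM_apply, map_sub]

/-- COMPLEX-EIGENPAIR REDUCTION of `WindDynamoExists` (landing pad for a certified eigenvalue
computation): if the real pair `(F₁, F₂)` of smooth divergence-free profiles is an eigenvector of
the real operator `L F = curl((B + ½y) × F) + ΔF` for the complex eigenvalue `λ = μ + iν`,
`μ ≥ 0`, i.e. `L F₁ = μ F₁ − ν F₂`, `L F₂ = ν F₁ + μ F₂` pointwise, with
`(1+|y|)²(|F₁| + |F₂|) ≤ K` and `F₁ ≢ 0`, then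
`Ω(s,·) = Re(e^{λ s}(F₁ + iF₂)) = e^{μs}(cos(νs) F₁ − sin(νs) F₂)` is an eternal solution in the
class (for `ν ≠ 0` and an `m`-fold symmetric template this is a ROTATING WAVE). The steady
reduction `windDynamoExists_of_steadyProfile` is the case `ν = 0`, `F₂ = 0`. -/
theorem windDynamoExists_of_eigenpair (C μ ν K : ℝ)
    (B F₁ F₂ : EuclideanSpace ℝ (Fin 3) → EuclideanSpace ℝ (Fin 3))
    (hB : ContDiff ℝ (⊤ : ℕ∞) B) (hBdiv : VectorCalculus.IsDivFree B)
    (hBdec : ∀ y, (1 + ‖y‖) * ‖B y‖ + (1 + ‖y‖) ^ 2 * ‖fderiv ℝ B y‖ ≤ C)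
    (hF₁ : ContDiff ℝ (⊤ : ℕ∞) F₁) (hF₂ : ContDiff ℝ (⊤ : ℕ∞) F₂)
    (hdiv₁ : VectorCalculus.IsDivFree F₁) (hdiv₂ : VectorCalculus.IsDivFree F₂) (hμ : 0 ≤ μ)
    (hL₁ : ∀ y, μ • F₁ y - ν • F₂ y =
      curl (fun z => cross (B z + (1 / 2 : ℝ) • z) (F₁ z)) y + Δ F₁ y)
    (hL₂ : ∀ y, ν • F₁ y + μ • F₂ y =
      curl (fun z => cross (B z + (1 / 2 : ℝ) • z) (F₂ z)) y + Δ F₂ y)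
    (hdec : ∀ y, (1 + ‖y‖) ^ 2 * (‖F₁ y‖ + ‖F₂ y‖) ≤ K) (hF0 : F₁ ≠ 0) :
    WindDynamoExists := by
  -- amplitudes `c₁(s) = e^{μs} cos(νs)`, `c₂(s) = e^{μs} sin(νs)`;
  -- witness `Ω s = c₁ s • F₁ - c₂ s • F₂`
  set c₁ : ℝ → ℝ := fun s => Real.exp (μ * s) * Real.cos (ν * s) with hc₁
  set c₂ : ℝ → ℝ := fun s => Real.exp (μ * s) * Real.sin (ν * s) with hc₂
  set Ω : ℝ → EuclideanSpace ℝ (Fin 3) → EuclideanSpace ℝ (Fin 3) :=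
    fun s y => c₁ s • F₁ y - c₂ s • F₂ y with hΩdef
  have hFD₁ : Differentiable ℝ F₁ := hF₁.differentiable (by simp)
  have hFD₂ : Differentiable ℝ F₂ := hF₂.differentiable (by simp)
  have hBD : Differentiable ℝ B := hB.differentiable (by simp)
  have hWd : ∀ y,
      DifferentiableAt ℝ (fun z : EuclideanSpace ℝ (Fin 3) => B z + (1 / 2 : ℝ) • z) y :=
    fun y => by fun_prop
  -- derivatives of the amplitudes
  have hexpd : ∀ s, HasDerivAt (fun x : ℝ => Real.exp (μ * x)) (Real.exp (μ * s) * μ) s := by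
    intro s
    have h1 : HasDerivAt (fun x : ℝ => μ * x) (μ * 1) s := (hasDerivAt_id' s).const_mul μ
    have h2 : HasDerivAt (fun x : ℝ => Real.exp (μ * x)) (Real.exp (μ * s) * (μ * 1)) s :=
      (Real.hasDerivAt_exp (μ * s)).comp s h1
    exact h2.congr_deriv (by ring)
  have hcosd : ∀ s, HasDerivAt (fun x : ℝ => Real.cos (ν * x)) (-(Real.sin (ν * s) * ν)) s := by
    intro s
    have h1 : HasDerivAt (fun x : ℝ => ν * x) (ν * 1) s := (hasDerivAt_id' s).const_mul ν
    have h2 : HasDerivAt (fun x : ℝ => Real.cos (ν * x)) (-Real.sin (ν * s) * (ν * 1)) s :=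
      (Real.hasDerivAt_cos (ν * s)).comp s h1
    exact h2.congr_deriv (by ring)
  have hsind : ∀ s, HasDerivAt (fun x : ℝ => Real.sin (ν * x)) (Real.cos (ν * s) * ν) s := by
    intro s
    have h1 : HasDerivAt (fun x : ℝ => ν * x) (ν * 1) s := (hasDerivAt_id' s).const_mul ν
    have h2 : HasDerivAt (fun x : ℝ => Real.sin (ν * x)) (Real.cos (ν * s) * (ν * 1)) s :=
      (Real.hasDerivAt_sin (ν * s)).comp s h1
    exact h2.congr_deriv (by ring)
  have hc₁d : ∀ s, HasDerivAt c₁ (μ * c₁ s - ν * c₂ s) s := by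
    intro s
    have := (hexpd s).mul (hcosd s)
    refine this.congr_deriv ?_
    simp only [hc₁, hc₂]; ring
  have hc₂d : ∀ s, HasDerivAt c₂ (ν * c₁ s + μ * c₂ s) s := by
    intro s
    have := (hexpd s).mul (hsind s)
    refine this.congr_deriv ?_
    simp only [hc₁, hc₂]; ring
  refine ⟨C, B, hB, hBdiv, hBdec, Ω, μ, K, hμ, ?_, ?_, ?_, ?_, ?_⟩
  · -- joint smoothness
    have he : ContDiff ℝ ∞ (fun p : ℝ × EuclideanSpace ℝ (Fin 3) => Real.exp (μ * p.1)) :=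
      Real.contDiff_exp.comp (contDiff_const.mul contDiff_fst)
    have hco : ContDiff ℝ ∞ (fun p : ℝ × EuclideanSpace ℝ (Fin 3) => Real.cos (ν * p.1)) :=
      Real.contDiff_cos.comp (contDiff_const.mul contDiff_fst)
    have hsi : ContDiff ℝ ∞ (fun p : ℝ × EuclideanSpace ℝ (Fin 3) => Real.sin (ν * p.1)) :=
      Real.contDiff_sin.comp (contDiff_const.mul contDiff_fst)
    have h1 : ContDiff ℝ ∞ (fun p : ℝ × EuclideanSpace ℝ (Fin 3) => F₁ p.2) :=
      hF₁.comp contDiff_snd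
    have h2 : ContDiff ℝ ∞ (fun p : ℝ × EuclideanSpace ℝ (Fin 3) => F₂ p.2) :=
      hF₂.comp contDiff_snd
    have h3 : ContDiff ℝ ∞ (uncurry Ω) := by
      have : uncurry Ω = fun p : ℝ × EuclideanSpace ℝ (Fin 3) =>
          (Real.exp (μ * p.1) * Real.cos (ν * p.1)) • F₁ p.2 -
            (Real.exp (μ * p.1) * Real.sin (ν * p.1)) • F₂ p.2 := by
        funext p; rfl
      rw [this]
      exact ((he.mul hco).smul h1).sub ((he.mul hsi).smul h2)
    exact h3.contDiffOn
  · -- divergence-free slices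
    intro s x
    have hf : HasFDerivAt (Ω s) (c₁ s • fderiv ℝ F₁ x - c₂ s • fderiv ℝ F₂ x) x :=
      ((hFD₁ x).hasFDerivAt.const_smul (c₁ s)).sub ((hFD₂ x).hasFDerivAt.const_smul (c₂ s))
    have h1 := hdiv₁ x
    have h2 := hdiv₂ x
    simp only [VectorCalculus.divergence] at h1 h2 ⊢
    rw [hf.fderiv]
    simp [map_sub, map_smul, h1, h2]
  · -- the equation
    intro s y
    have ht : timeDerivWithin Set.univ Ω s y =
        (μ * c₁ s - ν * c₂ s) • F₁ y - (ν * c₁ s + μ * c₂ s) • F₂ y := by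
      rw [timeDerivWithin_apply, derivWithin_univ]
      exact (((hc₁d s).smul_const (F₁ y)).sub ((hc₂d s).smul_const (F₂ y))).deriv
    set W : EuclideanSpace ℝ (Fin 3) → EuclideanSpace ℝ (Fin 3) :=
      fun z => B z + (1 / 2 : ℝ) • z with hW
    set G₁ : EuclideanSpace ℝ (Fin 3) → EuclideanSpace ℝ (Fin 3) :=
      fun z => cross (W z) (F₁ z) with hG₁def
    set G₂ : EuclideanSpace ℝ (Fin 3) → EuclideanSpace ℝ (Fin 3) :=
      fun z => cross (W z) (F₂ z) with hG₂def
    have hG₁ : ∀ z, DifferentiableAt ℝ G₁ z :=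
      fun z => differentiableAt_windCross (hWd z) (hFD₁ z)
    have hG₂ : ∀ z, DifferentiableAt ℝ G₂ z :=
      fun z => differentiableAt_windCross (hWd z) (hFD₂ z)
    have hcross : (fun z => cross (W z) (Ω s z)) = fun z => c₁ s • G₁ z - c₂ s • G₂ z := by
      funext z
      show cross (W z) (c₁ s • F₁ z - c₂ s • F₂ z) = _
      rw [windCross_sub_right, windCross_smul_right, windCross_smul_right]
    have hd₁ : DifferentiableAt ℝ (fun z => c₁ s • G₁ z) y :=
      ((hG₁ y).hasFDerivAt.const_smul (c₁ s)).differentiableAt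
    have hd₂ : DifferentiableAt ℝ (fun z => c₂ s • G₂ z) y :=
      ((hG₂ y).hasFDerivAt.const_smul (c₂ s)).differentiableAt
    have hcurl : curl (fun z => cross (W z) (Ω s z)) y =
        c₁ s • curl G₁ y - c₂ s • curl G₂ y := by
      rw [hcross]
      refine (curl_sub hd₁ hd₂).trans ?_
      rw [curl_const_smul (hG₁ y), curl_const_smul (hG₂ y)]
    have h2le : ((2 : ℕ) : WithTop ℕ∞) ≤ ((⊤ : ℕ∞) : WithTop ℕ∞) := by norm_cast
    have hlap : Δ (Ω s) y = c₁ s • Δ F₁ y - c₂ s • Δ F₂ y := by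
      have hΩs : Ω s = (c₁ s • F₁) - (c₂ s • F₂) := by funext z; rfl
      have hA : ContDiffAt ℝ 2 (c₁ s • F₁) y := by
        show ContDiffAt ℝ 2 (fun z => c₁ s • F₁ z) y
        exact (hF₁.contDiffAt.of_le h2le).const_smul _
      have hB' : ContDiffAt ℝ 2 (c₂ s • F₂) y := by
        show ContDiffAt ℝ 2 (fun z => c₂ s • F₂ z) y
        exact (hF₂.contDiffAt.of_le h2le).const_smul _
      rw [hΩs, ContDiffAt.laplacian_sub hA hB',
        InnerProductSpace.laplacian_smul _ (hF₁.contDiffAt.of_le h2le),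
        InnerProductSpace.laplacian_smul _ (hF₂.contDiffAt.of_le h2le)]
    have e1' : curl G₁ y = μ • F₁ y - ν • F₂ y - Δ F₁ y := by rw [hL₁ y]; abel
    have e2' : curl G₂ y = ν • F₁ y + μ • F₂ y - Δ F₂ y := by rw [hL₂ y]; abel
    rw [ht, hcurl, hlap, e1', e2']
    module
  · -- growth class
    intro s y
    have hexp : 0 < Real.exp (μ * s) := Real.exp_pos _
    have hcos : |Real.cos (ν * s)| ≤ 1 := Real.abs_cos_le_one _
    have hsin : |Real.sin (ν * s)| ≤ 1 := Real.abs_sin_le_one _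
    have hn : ‖Ω s y‖ ≤ Real.exp (μ * s) * (‖F₁ y‖ + ‖F₂ y‖) := by
      show ‖c₁ s • F₁ y - c₂ s • F₂ y‖ ≤ _
      calc ‖c₁ s • F₁ y - c₂ s • F₂ y‖ ≤ ‖c₁ s • F₁ y‖ + ‖c₂ s • F₂ y‖ := norm_sub_le _ _
        _ = Real.exp (μ * s) * (|Real.cos (ν * s)| * ‖F₁ y‖) +
              Real.exp (μ * s) * (|Real.sin (ν * s)| * ‖F₂ y‖) := by
            simp only [hc₁, hc₂, norm_smul, Real.norm_eq_abs, abs_mul, abs_of_pos hexp]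
            ring
        _ ≤ Real.exp (μ * s) * (1 * ‖F₁ y‖) + Real.exp (μ * s) * (1 * ‖F₂ y‖) := by
            gcongr
        _ = Real.exp (μ * s) * (‖F₁ y‖ + ‖F₂ y‖) := by ring
    have hy : 0 ≤ (1 + ‖y‖) ^ 2 := by positivity
    calc (1 + ‖y‖) ^ 2 * ‖Ω s y‖
        ≤ (1 + ‖y‖) ^ 2 * (Real.exp (μ * s) * (‖F₁ y‖ + ‖F₂ y‖)) :=
          mul_le_mul_of_nonneg_left hn hy
      _ = ((1 + ‖y‖) ^ 2 * (‖F₁ y‖ + ‖F₂ y‖)) * Real.exp (μ * s) := by ring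
      _ ≤ K * Real.exp (μ * s) := mul_le_mul_of_nonneg_right (hdec y) hexp.le
  · -- nontriviality at `s = 0`
    have : Ω 0 = F₁ := by
      funext y
      simp [hΩdef, hc₁, hc₂]
    rw [this]
    exact hF0

end Summit.NavierStokesRegularity.NavierStokesRegularity.Theorems
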